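import Literature.Geometry.ComplexAnalytic.PhamBrieskornA3QuotientPieceHomology
import Literature.AlgebraicTopology.SingularHomology.HomologySelfMapTwoLocalPieces
import HarnessLib

/-!
# The homological two-ball datum of a self-map modelled on two disjoint local pieces (brick L6-4b of crux K1Q, stub S5)

Family `hodge`, layer `Literature/Geometry/ComplexAnalytic` (with a model-free §1 in the vocabulary of
`Literature.AlgebraicTopology.SingularHomology.HomologySelfMapTwoLocalPieces`). Written by the prover seat `hodge-nonav-prover-Ax` (g18),
crux K1Q `VeryGeneralQuaternionCommutatorsInHg` (route `Summits/HodgeConjecture/HodgeConjecture/Theses/Q8SymplecticPowers.lean`, stub S5):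
this file turns the GEOMETRIC local configuration of the monodromy of a d6 meridian — `X = A₁ ∪ A₂ ∪ B` (open), `A₁ ∩ A₂ = ∅`, `h = id`
on `B`, `h, τ` preserving `A₁, A₂`, `j` exchanging them, `τ⁴ = id`, and homeomorphisms `e_k : A_k ≃ₜ Q` onto a model piece `Q`
conjugating `h|A₁ ↦ h̄`, `τ|A₁ ↦ τ̄`, `h|A₂ ↦ h̄`, `τ³|A₂ ↦ τ̄` (the second piece is the `j`-conjugate of the first: `j⁻¹ τ j = τ⁻¹`) —
into the HOMOLOGICAL two-ball datum consumed by `Summit…Theorems.Q8MonodromyBireflectionAssembly.monodromyBireflection_of_twoBallDatum`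
(`W_k := im(Hₙ(A_k) → Hₙ(X))`: `τ_*`-stable with square `−1`, exchanged by `j_*`, `h_* y − y ∈ W₁ + W₂`, `h_* = τ_*` on `W₁`,
`h_* τ_* = 1` on `W₂`, `dim W_k ≤ dim Hₙ(Q)`), given the model facts `τ̄_*² = −1`, `h̄_* = τ̄_*` on `Hₙ(Q)`.

* §1 **`twoBallDatum_of_localConfiguration`** (any field, any model `Q`).
* §2 **`twoBallDatum_of_localConfiguration_A3`** — the model `Q = F°∕ι` of `PhamBrieskornA3QuotientPieceHomology` (`p = 4`, `n = 2`, `ℚ`):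
  the model facts are `quotientPiece_package_homology`, so only the configuration is assumed; `dim W_k ≤ 2`.

Honest scope: the EXISTENCE of the configuration for the quaternionic family (the geometric monodromy of a d6 meridian, brick L6-4a) and
the rank equalities `dim W_k = 2` / the orthogonality of the two carriers are NOT addressed here.

## References

* [HatcherAT2002] A. Hatcher, Algebraic Topology, CUP 2002, §2.1 (functoriality, homotopy invariance), §2.2 (Mayer–Vietoris).
* [Milnor1968] J. Milnor, Singular Points of Complex Hypersurfaces, §9.
-/

noncomputable section

open CategoryTheory Set ContinuousMap

namespace Literature.AlgebraicTopology.SingularHomology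

namespace singularHomology

/-! ### §1 The model-free statement -/

section Generic

variable (F : Type) [Field F] {X Q : Type} [TopologicalSpace X] [TopologicalSpace Q]

/-- `g_* ∘ ι_* = ι_* ∘ (g|)_*` for a self-map `g` of `X` mapping `A` into `A'` (`ι, ι'` the inclusions). [cite: HatcherAT2002, §2.1] -/
theorem map_map_subsetIncl_of_mapsTo {A A' : Set X} (g : C(X, X)) (hg : MapsTo g A A') (n : ℕ) (a : singularHomology F F (↥A) n) :
    map F F g n (map F F (subsetIncl A) n a) =
      map F F (subsetIncl A') n (map F F (⟨hg.restrict g A A', (g.continuous.comp continuous_subtype_val).subtype_mk _⟩ : C(↥A, ↥A')) n a) := by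
  rw [← ModuleCat.comp_apply, ← map_comp, ← ModuleCat.comp_apply, ← map_comp]
  rfl

/-- `g_*` maps `im(Hₙ(A) → Hₙ(X))` into `im(Hₙ(A') → Hₙ(X))` when `g(A) ⊆ A'`. [cite: HatcherAT2002, §2.1] -/
theorem map_mem_range_of_mapsTo {A A' : Set X} (g : C(X, X)) (hg : MapsTo g A A') (n : ℕ) :
    ∀ v ∈ LinearMap.range (map F F (subsetIncl A) n).hom, map F F g n v ∈ LinearMap.range (map F F (subsetIncl A') n).hom := by
  rintro _ ⟨a, rfl⟩
  exact ⟨_, (map_map_subsetIncl_of_mapsTo F g hg n a).symm⟩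

/-- `restrictSelf τ` composed four times is the identity when `τ⁴ = id`. [cite: HatcherAT2002, §2.1] -/
theorem restrictSelf_pow_four_eq_id {A : Set X} (τ : C(X, X)) (hτA : MapsTo τ A A) (hτ4 : ∀ x, τ (τ (τ (τ x))) = x) :
    (restrictSelf τ hτA).comp ((restrictSelf τ hτA).comp ((restrictSelf τ hτA).comp (restrictSelf τ hτA))) = ContinuousMap.id ↥A := by
  ext a
  simp only [ContinuousMap.comp_apply, restrictSelf_apply_coe, ContinuousMap.id_apply, hτ4]

/-- On homology: `(τ|_A)_*⁴ = 1`. [cite: HatcherAT2002, §2.1] -/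
theorem map_restrictSelf_pow_four {A : Set X} (τ : C(X, X)) (hτA : MapsTo τ A A) (hτ4 : ∀ x, τ (τ (τ (τ x))) = x) (n : ℕ)
    (a : singularHomology F F (↥A) n) :
    map F F (restrictSelf τ hτA) n (map F F (restrictSelf τ hτA) n (map F F (restrictSelf τ hτA) n (map F F (restrictSelf τ hτA) n a))) = a := by
  have h := restrictSelf_pow_four_eq_id τ hτA hτ4
  have : map F F ((restrictSelf τ hτA).comp ((restrictSelf τ hτA).comp ((restrictSelf τ hτA).comp (restrictSelf τ hτA)))) n a = a := by
    rw [h, map_id]; rfl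
  simpa only [map_comp, ModuleCat.comp_apply] using this

/-- **The homological two-ball datum from a local configuration.** `X = A₁ ∪ A₂ ∪ B` open, `A₁ ∩ A₂ = ∅`, `h = id` on `B`; `h, τ`
preserve `A₁, A₂`, `j` exchanges them, `τ⁴ = id`; a model piece `Q` with self-maps `h̄, τ̄` satisfying `τ̄_*² = −1`, `h̄_* = τ̄_*` on
`Hₙ(Q; F)`; homeomorphisms `e₁ : A₁ ≃ₜ Q` conjugating `h|A₁ ↦ h̄`, `τ|A₁ ↦ τ̄` and `e₂ : A₂ ≃ₜ Q` conjugating `h|A₂ ↦ h̄`, `τ³|A₂ ↦ τ̄`.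
Then for `W_k := im(Hₙ(A_k; F) → Hₙ(X; F))`: `τ_* W_k ⊆ W_k`, `τ_*² = −1` on `W_k`, `j_* W₁ ⊆ W₂`, `j_* W₂ ⊆ W₁`, `h_* y − y ∈ W₁ + W₂`
for all `y`, `h_* = τ_*` on `W₁`, `h_* τ_* = 1` on `W₂`, and `dim W_k ≤ dim Hₙ(Q; F)`.
[cite: HatcherAT2002, §2.1 and §2.2] -/
theorem twoBallDatum_of_localConfiguration {n : ℕ} [Module.Finite F (singularHomology F F Q n)] {A₁ A₂ B : Set X} (h1o : IsOpen A₁)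
    (h2o : IsOpen A₂) (hBo : IsOpen B) (hcov : A₁ ∪ A₂ ∪ B = univ) (hdisj : Disjoint A₁ A₂) (h τ j : C(X, X))
    (hB : ∀ x ∈ B, h x = x) (hhA₁ : MapsTo h A₁ A₁) (hhA₂ : MapsTo h A₂ A₂) (hτA₁ : MapsTo τ A₁ A₁) (hτA₂ : MapsTo τ A₂ A₂)
    (hjA₁ : MapsTo j A₁ A₂) (hjA₂ : MapsTo j A₂ A₁) (hτ4 : ∀ x, τ (τ (τ (τ x))) = x) (hb tb : C(Q, Q))
    (hsq : ∀ w : singularHomology F F Q n, map F F tb n (map F F tb n w) = -w)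
    (hmod : ∀ w : singularHomology F F Q n, map F F hb n w = map F F tb n w)
    (e₁ : ↥A₁ ≃ₜ Q) (he₁h : (e₁ : C(↥A₁, Q)).comp (restrictSelf h hhA₁) = hb.comp (e₁ : C(↥A₁, Q)))
    (he₁τ : (e₁ : C(↥A₁, Q)).comp (restrictSelf τ hτA₁) = tb.comp (e₁ : C(↥A₁, Q)))
    (e₂ : ↥A₂ ≃ₜ Q) (he₂h : (e₂ : C(↥A₂, Q)).comp (restrictSelf h hhA₂) = hb.comp (e₂ : C(↥A₂, Q)))
    (he₂τ : (e₂ : C(↥A₂, Q)).comp ((restrictSelf τ hτA₂).comp ((restrictSelf τ hτA₂).comp (restrictSelf τ hτA₂))) =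
      tb.comp (e₂ : C(↥A₂, Q))) :
    (∀ w ∈ LinearMap.range (map F F (subsetIncl A₁) n).hom, map F F τ n w ∈ LinearMap.range (map F F (subsetIncl A₁) n).hom) ∧
    (∀ w ∈ LinearMap.range (map F F (subsetIncl A₂) n).hom, map F F τ n w ∈ LinearMap.range (map F F (subsetIncl A₂) n).hom) ∧
    (∀ w ∈ LinearMap.range (map F F (subsetIncl A₁) n).hom, map F F τ n (map F F τ n w) = -w) ∧
    (∀ w ∈ LinearMap.range (map F F (subsetIncl A₂) n).hom, map F F τ n (map F F τ n w) = -w) ∧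
    (∀ w ∈ LinearMap.range (map F F (subsetIncl A₁) n).hom, map F F j n w ∈ LinearMap.range (map F F (subsetIncl A₂) n).hom) ∧
    (∀ w ∈ LinearMap.range (map F F (subsetIncl A₂) n).hom, map F F j n w ∈ LinearMap.range (map F F (subsetIncl A₁) n).hom) ∧
    (∀ y : singularHomology F F X n,
      map F F h n y - y ∈ LinearMap.range (map F F (subsetIncl A₁) n).hom ⊔ LinearMap.range (map F F (subsetIncl A₂) n).hom) ∧
    (∀ w ∈ LinearMap.range (map F F (subsetIncl A₁) n).hom, map F F h n w = map F F τ n w) ∧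
    (∀ w ∈ LinearMap.range (map F F (subsetIncl A₂) n).hom, map F F h n (map F F τ n w) = w) ∧
    Module.finrank F ↥(LinearMap.range (map F F (subsetIncl A₁) n).hom) ≤ Module.finrank F (singularHomology F F Q n) ∧
    Module.finrank F ↥(LinearMap.range (map F F (subsetIncl A₂) n).hom) ≤ Module.finrank F (singularHomology F F Q n) := by
  -- the local packages on `A₁` (for `h|, τ|`) and on `A₂` (for `h|, τ³|`)
  obtain ⟨hd₁, hs₁, hg₁⟩ := Literature.Geometry.ComplexAnalytic.PhamBrieskorn.localPiece_of_conj F e₁ (restrictSelf h hhA₁) (restrictSelf τ hτA₁) hb tb he₁h he₁τ n hsq hmod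
  obtain ⟨hd₂, hs₂, hg₂⟩ := Literature.Geometry.ComplexAnalytic.PhamBrieskorn.localPiece_of_conj F e₂ (restrictSelf h hhA₂)
    ((restrictSelf τ hτA₂).comp ((restrictSelf τ hτA₂).comp (restrictSelf τ hτA₂))) hb tb he₂h he₂τ n hsq hmod
  haveI : Module.Finite F (singularHomology F F (↥A₁) n) := Module.Finite.equiv (singularHomology.mapIso F F e₁ n).toLinearEquiv.symm
  haveI : Module.Finite F (singularHomology F F (↥A₂) n) := Module.Finite.equiv (singularHomology.mapIso F F e₂ n).toLinearEquiv.symm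
  -- `τ|_{A₂}` : square `−1` from `(τ³|)² = −1` and `τ⁴ = 1`
  have hτ₂sq : ∀ a : singularHomology F F (↥A₂) n,
      map F F (restrictSelf τ hτA₂) n (map F F (restrictSelf τ hτA₂) n a) = -a := fun a => by
    have h3 := hs₂ (map F F (restrictSelf τ hτA₂) n (map F F (restrictSelf τ hτA₂) n a))
    simp only [map_comp, ModuleCat.comp_apply] at h3
    rw [map_restrictSelf_pow_four F τ hτA₂ hτ4 n, map_restrictSelf_pow_four F τ hτA₂ hτ4 n] at h3
    exact neg_eq_iff_eq_neg.mp h3.symm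
  -- `h| ∘ τ| = id` on `Hₙ(A₂)`
  have hhτ₂ : ∀ a : singularHomology F F (↥A₂) n,
      map F F (restrictSelf h hhA₂) n (map F F (restrictSelf τ hτA₂) n a) = a := fun a => by
    rw [hg₂]
    simp only [map_comp, ModuleCat.comp_apply]
    exact map_restrictSelf_pow_four F τ hτA₂ hτ4 n a
  refine ⟨map_mem_range_of_restrict F F τ (restrictSelf τ hτA₁) (fun a => rfl) n,
    map_mem_range_of_restrict F F τ (restrictSelf τ hτA₂) (fun a => rfl) n, ?_, ?_,
    map_mem_range_of_mapsTo F j hjA₁ n, map_mem_range_of_mapsTo F j hjA₂ n,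
    fun y => map_sub_self_mem_sup_range_of_eqOn₂ F F h1o h2o hBo hcov hdisj h hB hhA₁ hhA₂ n y,
    map_eq_map_of_restrict_eq F F h τ (restrictSelf h hhA₁) (restrictSelf τ hτA₁) (fun a => rfl) (fun a => rfl) n hg₁,
    map_map_eq_self_of_restrict_eq F F h τ (restrictSelf h hhA₂) (restrictSelf τ hτA₂) (fun a => rfl) (fun a => rfl) n hhτ₂,
    (finrank_range_map_subsetIncl_le (R := F) (M := F) n).trans hd₁.le,
    (finrank_range_map_subsetIncl_le (R := F) (M := F) n).trans hd₂.le⟩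
  · rintro _ ⟨a, rfl⟩
    change map F F τ n (map F F τ n (map F F (subsetIncl A₁) n a)) = -map F F (subsetIncl A₁) n a
    rw [map_map_subsetIncl_of_mapsTo F τ hτA₁ n, map_map_subsetIncl_of_mapsTo F τ hτA₁ n, ← map_neg]
    exact congrArg _ (hs₁ a)
  · rintro _ ⟨a, rfl⟩
    change map F F τ n (map F F τ n (map F F (subsetIncl A₂) n a)) = -map F F (subsetIncl A₂) n a
    rw [map_map_subsetIncl_of_mapsTo F τ hτA₂ n, map_map_subsetIncl_of_mapsTo F τ hτA₂ n, ← map_neg]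
    exact congrArg _ (hτ₂sq a)

end Generic

end singularHomology

end Literature.AlgebraicTopology.SingularHomology

namespace Literature.Geometry.ComplexAnalytic

namespace PhamBrieskorn

/-! ### §2 The model `F°∕ι` of the d6 degeneration (`p = 4`, `n = 2`, `ℚ`) -/

section A3

open Literature.AlgebraicTopology.SingularHomology

variable {ζ : ℂ} (hζ : IsPrimitiveRoot ζ 4) {X : Type} [TopologicalSpace X]

attribute [local instance] OrbitSpace.homeoMulAction

/-- **The homological two-ball datum of the d6 monodromy, from its local configuration** (model `Q = F°∕ι`, the free quotient of the
punctured Milnor fibre of `z₀² + z₁² + z₂⁴` by `ι`, with `τ̄` and the descended model monodromy `h̄`; the model facts are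
`quotientPiece_package_homology`): for `W_k := im(H₂(A_k; ℚ) → H₂(X; ℚ))`, `τ_* W_k ⊆ W_k`, `τ_*² = −1` on `W_k`, `j_*` exchanges
`W₁, W₂`, `h_* y − y ∈ W₁ + W₂`, `h_* = τ_*` on `W₁`, `h_* τ_* = 1` on `W₂`, `dim W_k ≤ 2`.
[cite: Milnor1968, §9 Thm. 9.1] [cite: HatcherAT2002, §2.1 and §2.2] -/
theorem twoBallDatum_of_localConfiguration_A3 {A₁ A₂ B : Set X} (h1o : IsOpen A₁) (h2o : IsOpen A₂) (hBo : IsOpen B)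
    (hcov : A₁ ∪ A₂ ∪ B = univ) (hdisj : Disjoint A₁ A₂) (h τ j : C(X, X)) (hB : ∀ x ∈ B, h x = x) (hhA₁ : MapsTo h A₁ A₁)
    (hhA₂ : MapsTo h A₂ A₂) (hτA₁ : MapsTo τ A₁ A₁) (hτA₂ : MapsTo τ A₂ A₂) (hjA₁ : MapsTo j A₁ A₂) (hjA₂ : MapsTo j A₂ A₁)
    (hτ4 : ∀ x, τ (τ (τ (τ x))) = x)
    (e₁ : ↥A₁ ≃ₜ OrbitSpace (iotaPunct 4 four_ne_zero (by decide)))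
    (he₁h : (e₁ : C(↥A₁, OrbitSpace (iotaPunct 4 four_ne_zero (by decide)))).comp (singularHomology.restrictSelf h hhA₁) =
      ((OrbitSpace.map (negPairPunct 4 * rotatePunct 4 four_ne_zero ⟨ζ, hζ.pow_eq_one⟩)
        (commute_modelPunct_iotaPunct 4 four_ne_zero (by decide) ⟨ζ, hζ.pow_eq_one⟩) :
          C(OrbitSpace (iotaPunct 4 four_ne_zero (by decide)), OrbitSpace (iotaPunct 4 four_ne_zero (by decide)))).comp
        (e₁ : C(↥A₁, OrbitSpace (iotaPunct 4 four_ne_zero (by decide))))))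
    (he₁τ : (e₁ : C(↥A₁, OrbitSpace (iotaPunct 4 four_ne_zero (by decide)))).comp (singularHomology.restrictSelf τ hτA₁) =
      ((OrbitSpace.map (rotatePunct 4 four_ne_zero ⟨ζ, hζ.pow_eq_one⟩)
        (commute_rotatePunct_iotaPunct 4 four_ne_zero (by decide) ⟨ζ, hζ.pow_eq_one⟩) :
          C(OrbitSpace (iotaPunct 4 four_ne_zero (by decide)), OrbitSpace (iotaPunct 4 four_ne_zero (by decide)))).comp
        (e₁ : C(↥A₁, OrbitSpace (iotaPunct 4 four_ne_zero (by decide))))))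
    (e₂ : ↥A₂ ≃ₜ OrbitSpace (iotaPunct 4 four_ne_zero (by decide)))
    (he₂h : (e₂ : C(↥A₂, OrbitSpace (iotaPunct 4 four_ne_zero (by decide)))).comp (singularHomology.restrictSelf h hhA₂) =
      ((OrbitSpace.map (negPairPunct 4 * rotatePunct 4 four_ne_zero ⟨ζ, hζ.pow_eq_one⟩)
        (commute_modelPunct_iotaPunct 4 four_ne_zero (by decide) ⟨ζ, hζ.pow_eq_one⟩) :
          C(OrbitSpace (iotaPunct 4 four_ne_zero (by decide)), OrbitSpace (iotaPunct 4 four_ne_zero (by decide)))).comp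
        (e₂ : C(↥A₂, OrbitSpace (iotaPunct 4 four_ne_zero (by decide))))))
    (he₂τ : (e₂ : C(↥A₂, OrbitSpace (iotaPunct 4 four_ne_zero (by decide)))).comp
        ((singularHomology.restrictSelf τ hτA₂).comp ((singularHomology.restrictSelf τ hτA₂).comp (singularHomology.restrictSelf τ hτA₂))) =
      ((OrbitSpace.map (rotatePunct 4 four_ne_zero ⟨ζ, hζ.pow_eq_one⟩)
        (commute_rotatePunct_iotaPunct 4 four_ne_zero (by decide) ⟨ζ, hζ.pow_eq_one⟩) :
          C(OrbitSpace (iotaPunct 4 four_ne_zero (by decide)), OrbitSpace (iotaPunct 4 four_ne_zero (by decide)))).comp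
        (e₂ : C(↥A₂, OrbitSpace (iotaPunct 4 four_ne_zero (by decide)))))) :
    (∀ w ∈ LinearMap.range (singularHomology.map ℚ ℚ (subsetIncl A₁) 2).hom,
      singularHomology.map ℚ ℚ τ 2 w ∈ LinearMap.range (singularHomology.map ℚ ℚ (subsetIncl A₁) 2).hom) ∧
    (∀ w ∈ LinearMap.range (singularHomology.map ℚ ℚ (subsetIncl A₂) 2).hom,
      singularHomology.map ℚ ℚ τ 2 w ∈ LinearMap.range (singularHomology.map ℚ ℚ (subsetIncl A₂) 2).hom) ∧
    (∀ w ∈ LinearMap.range (singularHomology.map ℚ ℚ (subsetIncl A₁) 2).hom,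
      singularHomology.map ℚ ℚ τ 2 (singularHomology.map ℚ ℚ τ 2 w) = -w) ∧
    (∀ w ∈ LinearMap.range (singularHomology.map ℚ ℚ (subsetIncl A₂) 2).hom,
      singularHomology.map ℚ ℚ τ 2 (singularHomology.map ℚ ℚ τ 2 w) = -w) ∧
    (∀ w ∈ LinearMap.range (singularHomology.map ℚ ℚ (subsetIncl A₁) 2).hom,
      singularHomology.map ℚ ℚ j 2 w ∈ LinearMap.range (singularHomology.map ℚ ℚ (subsetIncl A₂) 2).hom) ∧
    (∀ w ∈ LinearMap.range (singularHomology.map ℚ ℚ (subsetIncl A₂) 2).hom,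
      singularHomology.map ℚ ℚ j 2 w ∈ LinearMap.range (singularHomology.map ℚ ℚ (subsetIncl A₁) 2).hom) ∧
    (∀ y : singularHomology ℚ ℚ X 2, singularHomology.map ℚ ℚ h 2 y - y ∈
      LinearMap.range (singularHomology.map ℚ ℚ (subsetIncl A₁) 2).hom ⊔ LinearMap.range (singularHomology.map ℚ ℚ (subsetIncl A₂) 2).hom) ∧
    (∀ w ∈ LinearMap.range (singularHomology.map ℚ ℚ (subsetIncl A₁) 2).hom,
      singularHomology.map ℚ ℚ h 2 w = singularHomology.map ℚ ℚ τ 2 w) ∧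
    (∀ w ∈ LinearMap.range (singularHomology.map ℚ ℚ (subsetIncl A₂) 2).hom,
      singularHomology.map ℚ ℚ h 2 (singularHomology.map ℚ ℚ τ 2 w) = w) ∧
    Module.finrank ℚ ↥(LinearMap.range (singularHomology.map ℚ ℚ (subsetIncl A₁) 2).hom) ≤ 2 ∧
    Module.finrank ℚ ↥(LinearMap.range (singularHomology.map ℚ ℚ (subsetIncl A₂) 2).hom) ≤ 2 := by
  obtain ⟨hdim, hsq, hmod⟩ := quotientPiece_package_homology hζ
  haveI : Module.Finite ℚ (singularHomology ℚ ℚ (OrbitSpace (iotaPunct 4 four_ne_zero (by decide))) 2) :=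
    Module.finite_of_finrank_pos (by rw [hdim]; exact two_pos)
  obtain ⟨h1, h2, h3, h4, h5, h6, h7, h8, h9, h10, h11⟩ :=
    singularHomology.twoBallDatum_of_localConfiguration ℚ h1o h2o hBo hcov hdisj h τ j hB hhA₁ hhA₂ hτA₁ hτA₂ hjA₁ hjA₂ hτ4 _ _
      hsq hmod e₁ he₁h he₁τ e₂ he₂h he₂τ
  exact ⟨h1, h2, h3, h4, h5, h6, h7, h8, h9, h10.trans hdim.le, h11.trans hdim.le⟩

end A3

end PhamBrieskorn

end Literature.Geometry.ComplexAnalytic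


/-! ### §3 Homological conjugacy (the form realised by a geometric monodromy, which is the identity near the boundary of its support)

The pointwise conjugacies `e ∘ h| = h̄ ∘ e` of §1–§2 cannot hold for a self-map `h` that is the identity on an open set meeting the
piece (the model `h̄` has isolated fixed points); a geometric monodromy is only ISOTOPIC, through a compactly supported modification, to
the model map on the piece — hence induces the same map on `Hₙ` of the piece. §3 therefore asks the conjugacies only ON HOMOLOGY
(`(e ∘ h|)_* = (h̄ ∘ e)_*`, implied by a homotopy `e ∘ h| ≃ h̄ ∘ e`, Hatcher Thm. 2.10), which is what the proofs use. -/

namespace Literature.AlgebraicTopology.SingularHomology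

namespace singularHomology

section HomologyConj

variable (F : Type) [Field F] {X Q : Type} [TopologicalSpace X] [TopologicalSpace Q]

/-- **Transport of the local-piece package along a homeomorphism conjugating ON HOMOLOGY.** If `e : A ≃ₜ Q` satisfies
`(e ∘ g)_* = (ḡ ∘ e)_*` and `(e ∘ s)_* = (s̄ ∘ e)_*` on `Hₙ`, and on `Hₙ(Q; F)`: `s̄_* s̄_* = −1`, `ḡ_* = s̄_*`, then the same holds for
`g, s` on `Hₙ(A; F)`, and `dim Hₙ(A; F) = dim Hₙ(Q; F)`. [cite: HatcherAT2002, §2.1 Thm. 2.10] -/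
theorem localPiece_of_homologyConj {A : Type} [TopologicalSpace A] (e : A ≃ₜ Q) (g s : C(A, A)) (gb sb : C(Q, Q)) (n : ℕ)
    (hg : map F F ((e : C(A, Q)).comp g) n = map F F (gb.comp (e : C(A, Q))) n)
    (hs : map F F ((e : C(A, Q)).comp s) n = map F F (sb.comp (e : C(A, Q))) n)
    (hsq : ∀ w : singularHomology F F Q n, map F F sb n (map F F sb n w) = -w)
    (hmod : ∀ w : singularHomology F F Q n, map F F gb n w = map F F sb n w) :
    Module.finrank F (singularHomology F F A n) = Module.finrank F (singularHomology F F Q n) ∧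
    (∀ z : singularHomology F F A n, map F F s n (map F F s n z) = -z) ∧
    (∀ z : singularHomology F F A n, map F F g n z = map F F s n z) := by
  have hinj : Function.Injective (map F F (e : C(A, Q)) n) :=
    ((forget (ModuleCat F)).mapIso (singularHomology.mapIso F F e n)).toEquiv.injective
  have hs' : ∀ z : singularHomology F F A n, map F F (e : C(A, Q)) n (map F F s n z) = map F F sb n (map F F (e : C(A, Q)) n z) :=
    fun z => by
      rw [← ModuleCat.comp_apply, ← map_comp, hs, map_comp, ModuleCat.comp_apply]
  have hg' : ∀ z : singularHomology F F A n, map F F (e : C(A, Q)) n (map F F g n z) = map F F gb n (map F F (e : C(A, Q)) n z) :=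
    fun z => by
      rw [← ModuleCat.comp_apply, ← map_comp, hg, map_comp, ModuleCat.comp_apply]
  refine ⟨(singularHomology.mapIso F F e n).toLinearEquiv.finrank_eq, fun z => hinj ?_, fun z => hinj ?_⟩
  · rw [hs', hs', hsq, map_neg]
  · rw [hg', hs', hmod]

/-- A homotopy `e ∘ g ≃ ḡ ∘ e` gives the homological conjugacy. [cite: HatcherAT2002, §2.1 Thm. 2.10] -/
theorem map_comp_eq_of_homotopic {A : Type} [TopologicalSpace A] (e : C(A, Q)) (g : C(A, A)) (gb : C(Q, Q)) (n : ℕ)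
    (h : (e.comp g).Homotopic (gb.comp e)) : map F F (e.comp g) n = map F F (gb.comp e) n :=
  map_eq_of_homotopic F F h n

/-- **The homological two-ball datum from a local configuration, homological-conjugacy form** (the satisfiable one: see the §3 header).
Hypotheses as in `twoBallDatum_of_localConfiguration` except that the four conjugacies to the model are asked on `Hₙ` only.
[cite: HatcherAT2002, §2.1 and §2.2] -/
theorem twoBallDatum_of_localConfiguration' {n : ℕ} [Module.Finite F (singularHomology F F Q n)] {A₁ A₂ B : Set X}
    (h1o : IsOpen A₁) (h2o : IsOpen A₂) (hBo : IsOpen B) (hcov : A₁ ∪ A₂ ∪ B = univ) (hdisj : Disjoint A₁ A₂) (h τ j : C(X, X))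
    (hB : ∀ x ∈ B, h x = x) (hhA₁ : MapsTo h A₁ A₁) (hhA₂ : MapsTo h A₂ A₂) (hτA₁ : MapsTo τ A₁ A₁) (hτA₂ : MapsTo τ A₂ A₂)
    (hjA₁ : MapsTo j A₁ A₂) (hjA₂ : MapsTo j A₂ A₁) (hτ4 : ∀ x, τ (τ (τ (τ x))) = x) (hb tb : C(Q, Q))
    (hsq : ∀ w : singularHomology F F Q n, map F F tb n (map F F tb n w) = -w)
    (hmod : ∀ w : singularHomology F F Q n, map F F hb n w = map F F tb n w)
    (e₁ : ↥A₁ ≃ₜ Q) (he₁h : map F F ((e₁ : C(↥A₁, Q)).comp (restrictSelf h hhA₁)) n = map F F (hb.comp (e₁ : C(↥A₁, Q))) n)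
    (he₁τ : map F F ((e₁ : C(↥A₁, Q)).comp (restrictSelf τ hτA₁)) n = map F F (tb.comp (e₁ : C(↥A₁, Q))) n)
    (e₂ : ↥A₂ ≃ₜ Q) (he₂h : map F F ((e₂ : C(↥A₂, Q)).comp (restrictSelf h hhA₂)) n = map F F (hb.comp (e₂ : C(↥A₂, Q))) n)
    (he₂τ : map F F ((e₂ : C(↥A₂, Q)).comp ((restrictSelf τ hτA₂).comp ((restrictSelf τ hτA₂).comp (restrictSelf τ hτA₂)))) n =
      map F F (tb.comp (e₂ : C(↥A₂, Q))) n) :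
    (∀ w ∈ LinearMap.range (map F F (subsetIncl A₁) n).hom, map F F τ n w ∈ LinearMap.range (map F F (subsetIncl A₁) n).hom) ∧
    (∀ w ∈ LinearMap.range (map F F (subsetIncl A₂) n).hom, map F F τ n w ∈ LinearMap.range (map F F (subsetIncl A₂) n).hom) ∧
    (∀ w ∈ LinearMap.range (map F F (subsetIncl A₁) n).hom, map F F τ n (map F F τ n w) = -w) ∧
    (∀ w ∈ LinearMap.range (map F F (subsetIncl A₂) n).hom, map F F τ n (map F F τ n w) = -w) ∧
    (∀ w ∈ LinearMap.range (map F F (subsetIncl A₁) n).hom, map F F j n w ∈ LinearMap.range (map F F (subsetIncl A₂) n).hom) ∧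
    (∀ w ∈ LinearMap.range (map F F (subsetIncl A₂) n).hom, map F F j n w ∈ LinearMap.range (map F F (subsetIncl A₁) n).hom) ∧
    (∀ y : singularHomology F F X n,
      map F F h n y - y ∈ LinearMap.range (map F F (subsetIncl A₁) n).hom ⊔ LinearMap.range (map F F (subsetIncl A₂) n).hom) ∧
    (∀ w ∈ LinearMap.range (map F F (subsetIncl A₁) n).hom, map F F h n w = map F F τ n w) ∧
    (∀ w ∈ LinearMap.range (map F F (subsetIncl A₂) n).hom, map F F h n (map F F τ n w) = w) ∧
    Module.finrank F ↥(LinearMap.range (map F F (subsetIncl A₁) n).hom) ≤ Module.finrank F (singularHomology F F Q n) ∧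
    Module.finrank F ↥(LinearMap.range (map F F (subsetIncl A₂) n).hom) ≤ Module.finrank F (singularHomology F F Q n) := by
  obtain ⟨hd₁, hs₁, hg₁⟩ := localPiece_of_homologyConj F e₁ (restrictSelf h hhA₁) (restrictSelf τ hτA₁) hb tb n he₁h he₁τ hsq hmod
  obtain ⟨hd₂, hs₂, hg₂⟩ := localPiece_of_homologyConj F e₂ (restrictSelf h hhA₂)
    ((restrictSelf τ hτA₂).comp ((restrictSelf τ hτA₂).comp (restrictSelf τ hτA₂))) hb tb n he₂h he₂τ hsq hmod
  haveI : Module.Finite F (singularHomology F F (↥A₁) n) := Module.Finite.equiv (singularHomology.mapIso F F e₁ n).toLinearEquiv.symm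
  haveI : Module.Finite F (singularHomology F F (↥A₂) n) := Module.Finite.equiv (singularHomology.mapIso F F e₂ n).toLinearEquiv.symm
  have hτ₂sq : ∀ a : singularHomology F F (↥A₂) n,
      map F F (restrictSelf τ hτA₂) n (map F F (restrictSelf τ hτA₂) n a) = -a := fun a => by
    have h3 := hs₂ (map F F (restrictSelf τ hτA₂) n (map F F (restrictSelf τ hτA₂) n a))
    simp only [map_comp, ModuleCat.comp_apply] at h3
    rw [map_restrictSelf_pow_four F τ hτA₂ hτ4 n, map_restrictSelf_pow_four F τ hτA₂ hτ4 n] at h3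
    exact neg_eq_iff_eq_neg.mp h3.symm
  have hhτ₂ : ∀ a : singularHomology F F (↥A₂) n,
      map F F (restrictSelf h hhA₂) n (map F F (restrictSelf τ hτA₂) n a) = a := fun a => by
    rw [hg₂]
    simp only [map_comp, ModuleCat.comp_apply]
    exact map_restrictSelf_pow_four F τ hτA₂ hτ4 n a
  refine ⟨map_mem_range_of_restrict F F τ (restrictSelf τ hτA₁) (fun a => rfl) n,
    map_mem_range_of_restrict F F τ (restrictSelf τ hτA₂) (fun a => rfl) n, ?_, ?_,
    map_mem_range_of_mapsTo F j hjA₁ n, map_mem_range_of_mapsTo F j hjA₂ n,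
    fun y => map_sub_self_mem_sup_range_of_eqOn₂ F F h1o h2o hBo hcov hdisj h hB hhA₁ hhA₂ n y,
    map_eq_map_of_restrict_eq F F h τ (restrictSelf h hhA₁) (restrictSelf τ hτA₁) (fun a => rfl) (fun a => rfl) n hg₁,
    map_map_eq_self_of_restrict_eq F F h τ (restrictSelf h hhA₂) (restrictSelf τ hτA₂) (fun a => rfl) (fun a => rfl) n hhτ₂,
    (finrank_range_map_subsetIncl_le (R := F) (M := F) n).trans hd₁.le,
    (finrank_range_map_subsetIncl_le (R := F) (M := F) n).trans hd₂.le⟩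
  · rintro _ ⟨a, rfl⟩
    change map F F τ n (map F F τ n (map F F (subsetIncl A₁) n a)) = -map F F (subsetIncl A₁) n a
    rw [map_map_subsetIncl_of_mapsTo F τ hτA₁ n, map_map_subsetIncl_of_mapsTo F τ hτA₁ n, ← map_neg]
    exact congrArg _ (hs₁ a)
  · rintro _ ⟨a, rfl⟩
    change map F F τ n (map F F τ n (map F F (subsetIncl A₂) n a)) = -map F F (subsetIncl A₂) n a
    rw [map_map_subsetIncl_of_mapsTo F τ hτA₂ n, map_map_subsetIncl_of_mapsTo F τ hτA₂ n, ← map_neg]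
    exact congrArg _ (hτ₂sq a)

end HomologyConj

end singularHomology

end Literature.AlgebraicTopology.SingularHomology

namespace Literature.Geometry.ComplexAnalytic

namespace PhamBrieskorn

section A3'

open Literature.AlgebraicTopology.SingularHomology

variable {ζ : ℂ} (hζ : IsPrimitiveRoot ζ 4) {X : Type} [TopologicalSpace X]

attribute [local instance] OrbitSpace.homeoMulAction

/-- **The homological two-ball datum of the d6 monodromy from its local configuration — homological-conjugacy form** (model `Q = F°∕ι`,
`p = 4`, `n = 2`, `ℚ`; the four conjugacies to `(h̄, τ̄)` asked on `H₂` only, as induced by homotopies). [cite: Milnor1968, §9 Thm. 9.1]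
[cite: HatcherAT2002, §2.1 and §2.2] -/
theorem twoBallDatum_of_localConfiguration_A3' {A₁ A₂ B : Set X} (h1o : IsOpen A₁) (h2o : IsOpen A₂) (hBo : IsOpen B)
    (hcov : A₁ ∪ A₂ ∪ B = univ) (hdisj : Disjoint A₁ A₂) (h τ j : C(X, X)) (hB : ∀ x ∈ B, h x = x) (hhA₁ : MapsTo h A₁ A₁)
    (hhA₂ : MapsTo h A₂ A₂) (hτA₁ : MapsTo τ A₁ A₁) (hτA₂ : MapsTo τ A₂ A₂) (hjA₁ : MapsTo j A₁ A₂) (hjA₂ : MapsTo j A₂ A₁)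
    (hτ4 : ∀ x, τ (τ (τ (τ x))) = x)
    (e₁ : ↥A₁ ≃ₜ OrbitSpace (iotaPunct 4 four_ne_zero (by decide)))
    (he₁h : singularHomology.map ℚ ℚ ((e₁ : C(↥A₁, OrbitSpace (iotaPunct 4 four_ne_zero (by decide)))).comp
        (singularHomology.restrictSelf h hhA₁)) 2 =
      singularHomology.map ℚ ℚ (((OrbitSpace.map (negPairPunct 4 * rotatePunct 4 four_ne_zero ⟨ζ, hζ.pow_eq_one⟩)
        (commute_modelPunct_iotaPunct 4 four_ne_zero (by decide) ⟨ζ, hζ.pow_eq_one⟩) :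
          C(OrbitSpace (iotaPunct 4 four_ne_zero (by decide)), OrbitSpace (iotaPunct 4 four_ne_zero (by decide)))).comp
        (e₁ : C(↥A₁, OrbitSpace (iotaPunct 4 four_ne_zero (by decide)))))) 2)
    (he₁τ : singularHomology.map ℚ ℚ ((e₁ : C(↥A₁, OrbitSpace (iotaPunct 4 four_ne_zero (by decide)))).comp
        (singularHomology.restrictSelf τ hτA₁)) 2 =
      singularHomology.map ℚ ℚ (((OrbitSpace.map (rotatePunct 4 four_ne_zero ⟨ζ, hζ.pow_eq_one⟩)
        (commute_rotatePunct_iotaPunct 4 four_ne_zero (by decide) ⟨ζ, hζ.pow_eq_one⟩) :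
          C(OrbitSpace (iotaPunct 4 four_ne_zero (by decide)), OrbitSpace (iotaPunct 4 four_ne_zero (by decide)))).comp
        (e₁ : C(↥A₁, OrbitSpace (iotaPunct 4 four_ne_zero (by decide)))))) 2)
    (e₂ : ↥A₂ ≃ₜ OrbitSpace (iotaPunct 4 four_ne_zero (by decide)))
    (he₂h : singularHomology.map ℚ ℚ ((e₂ : C(↥A₂, OrbitSpace (iotaPunct 4 four_ne_zero (by decide)))).comp
        (singularHomology.restrictSelf h hhA₂)) 2 =
      singularHomology.map ℚ ℚ (((OrbitSpace.map (negPairPunct 4 * rotatePunct 4 four_ne_zero ⟨ζ, hζ.pow_eq_one⟩)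
        (commute_modelPunct_iotaPunct 4 four_ne_zero (by decide) ⟨ζ, hζ.pow_eq_one⟩) :
          C(OrbitSpace (iotaPunct 4 four_ne_zero (by decide)), OrbitSpace (iotaPunct 4 four_ne_zero (by decide)))).comp
        (e₂ : C(↥A₂, OrbitSpace (iotaPunct 4 four_ne_zero (by decide)))))) 2)
    (he₂τ : singularHomology.map ℚ ℚ ((e₂ : C(↥A₂, OrbitSpace (iotaPunct 4 four_ne_zero (by decide)))).comp
        ((singularHomology.restrictSelf τ hτA₂).comp ((singularHomology.restrictSelf τ hτA₂).comp
          (singularHomology.restrictSelf τ hτA₂)))) 2 =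
      singularHomology.map ℚ ℚ (((OrbitSpace.map (rotatePunct 4 four_ne_zero ⟨ζ, hζ.pow_eq_one⟩)
        (commute_rotatePunct_iotaPunct 4 four_ne_zero (by decide) ⟨ζ, hζ.pow_eq_one⟩) :
          C(OrbitSpace (iotaPunct 4 four_ne_zero (by decide)), OrbitSpace (iotaPunct 4 four_ne_zero (by decide)))).comp
        (e₂ : C(↥A₂, OrbitSpace (iotaPunct 4 four_ne_zero (by decide)))))) 2) :
    (∀ w ∈ LinearMap.range (singularHomology.map ℚ ℚ (subsetIncl A₁) 2).hom,
      singularHomology.map ℚ ℚ τ 2 w ∈ LinearMap.range (singularHomology.map ℚ ℚ (subsetIncl A₁) 2).hom) ∧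
    (∀ w ∈ LinearMap.range (singularHomology.map ℚ ℚ (subsetIncl A₂) 2).hom,
      singularHomology.map ℚ ℚ τ 2 w ∈ LinearMap.range (singularHomology.map ℚ ℚ (subsetIncl A₂) 2).hom) ∧
    (∀ w ∈ LinearMap.range (singularHomology.map ℚ ℚ (subsetIncl A₁) 2).hom,
      singularHomology.map ℚ ℚ τ 2 (singularHomology.map ℚ ℚ τ 2 w) = -w) ∧
    (∀ w ∈ LinearMap.range (singularHomology.map ℚ ℚ (subsetIncl A₂) 2).hom,
      singularHomology.map ℚ ℚ τ 2 (singularHomology.map ℚ ℚ τ 2 w) = -w) ∧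
    (∀ w ∈ LinearMap.range (singularHomology.map ℚ ℚ (subsetIncl A₁) 2).hom,
      singularHomology.map ℚ ℚ j 2 w ∈ LinearMap.range (singularHomology.map ℚ ℚ (subsetIncl A₂) 2).hom) ∧
    (∀ w ∈ LinearMap.range (singularHomology.map ℚ ℚ (subsetIncl A₂) 2).hom,
      singularHomology.map ℚ ℚ j 2 w ∈ LinearMap.range (singularHomology.map ℚ ℚ (subsetIncl A₁) 2).hom) ∧
    (∀ y : singularHomology ℚ ℚ X 2, singularHomology.map ℚ ℚ h 2 y - y ∈
      LinearMap.range (singularHomology.map ℚ ℚ (subsetIncl A₁) 2).hom ⊔ LinearMap.range (singularHomology.map ℚ ℚ (subsetIncl A₂) 2).hom) ∧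
    (∀ w ∈ LinearMap.range (singularHomology.map ℚ ℚ (subsetIncl A₁) 2).hom,
      singularHomology.map ℚ ℚ h 2 w = singularHomology.map ℚ ℚ τ 2 w) ∧
    (∀ w ∈ LinearMap.range (singularHomology.map ℚ ℚ (subsetIncl A₂) 2).hom,
      singularHomology.map ℚ ℚ h 2 (singularHomology.map ℚ ℚ τ 2 w) = w) ∧
    Module.finrank ℚ ↥(LinearMap.range (singularHomology.map ℚ ℚ (subsetIncl A₁) 2).hom) ≤ 2 ∧
    Module.finrank ℚ ↥(LinearMap.range (singularHomology.map ℚ ℚ (subsetIncl A₂) 2).hom) ≤ 2 := by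
  obtain ⟨hdim, hsq, hmod⟩ := quotientPiece_package_homology hζ
  haveI : Module.Finite ℚ (singularHomology ℚ ℚ (OrbitSpace (iotaPunct 4 four_ne_zero (by decide))) 2) :=
    Module.finite_of_finrank_pos (by rw [hdim]; exact two_pos)
  obtain ⟨h1, h2, h3, h4, h5, h6, h7, h8, h9, h10, h11⟩ :=
    singularHomology.twoBallDatum_of_localConfiguration' ℚ h1o h2o hBo hcov hdisj h τ j hB hhA₁ hhA₂ hτA₁ hτA₂ hjA₁ hjA₂ hτ4 _ _
      hsq hmod e₁ he₁h he₁τ e₂ he₂h he₂τ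
  exact ⟨h1, h2, h3, h4, h5, h6, h7, h8, h9, h10.trans hdim.le, h11.trans hdim.le⟩

end A3'

end PhamBrieskorn

end Literature.Geometry.ComplexAnalytic

end
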